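import Summits.Ventures.HodgeRepro.Groups
import Summits.Ventures.HodgeRepro.Primitive

/-!
# Worked examples on the concrete groups (kernel `decide` benchmarks)

Blind re-derivation cell `pub-hodge-repro`, seat `typer` (gen 2).  Sanity checks of the interface on the
groups of `Groups.lean`; every statement is settled by kernel `decide` (no `native_decide`; the
`4096`-subset enumerations of order `12` use `decide +kernel`, which avoids the elaborator's recursion
limit and is ≈ 3× faster than `decide` with `maxRecDepth`).  The wall times recorded in `INDEX.md` tell
the provers what `decide` can afford on `|G| ≤ 12`.
-/

open Finset
open scoped Pointwise

namespace HodgeRepro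

/-! ### `C₆`: the CM types of the cyclic sextic field -/

/-- The "consecutive" CM type `{0, 1, 2}` of `C₆` (primitive, rank 4). -/
def Φ6 : Finset C6 := {Multiplicative.ofAdd 0, Multiplicative.ofAdd 1, Multiplicative.ofAdd 2}

/-- The CM type `{0, 2, 4}` of `C₆` induced from the imaginary quadratic subfield (`Φ · 2 = Φ`). -/
def Φ6' : Finset C6 := {Multiplicative.ofAdd 0, Multiplicative.ofAdd 2, Multiplicative.ofAdd 4}

/-- `Φ6` is a CM type of `C₆` (`decide`). -/
theorem isCMType_Φ6 : IsCMType cc_C6 Φ6 := by decide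

/-- `Φ6'` is a CM type of `C₆` (`decide`). -/
theorem isCMType_Φ6' : IsCMType cc_C6 Φ6' := by decide

/-- `Φ6` is primitive (`decide`). -/
theorem isPrimitive_Φ6 : IsPrimitive Φ6 := by decide

/-- `Φ6'` is not primitive (`decide`). -/
theorem not_isPrimitive_Φ6' : ¬ IsPrimitive Φ6' := by decide

/-- `2` stabilises `Φ6'` on the right: `Φ6'` is lifted from the imaginary quadratic subfield. -/
theorem two_mem_rstab_Φ6' : (Multiplicative.ofAdd 2 : C6) ∈ rstab Φ6' := by decide

/-- Exactly two of the 8 CM types of `C₆` are imprimitive (the two conjugate types lifted from the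
imaginary quadratic subfield). -/
theorem card_primitive_cmTypes_C6 : ((cmTypes cc_C6).filter fun Φ => IsPrimitive Φ).card = 6 := by
  decide

/-- The Hodge sets of size `2` for `Φ6`: the three conjugate pairs `{g, c g}` (divisor classes only). -/
theorem hodgeCount_Φ6_one : hodgeCount cc_C6 Φ6 1 = 3 := by decide

/-- `Φ6` has no exceptional Hodge set of size `2`. -/
theorem exceptionalCount_Φ6_one : exceptionalCount cc_C6 Φ6 1 = 0 := by decide

/-! ### `D₆`: a primitive and an imprimitive type -/

/-- A CM type of `D₆` with right stabiliser of order `2` (lifted from a non-Galois sextic subfield). -/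
def ΦD6 : Finset D6 :=
  {DihedralGroup.r 0, DihedralGroup.r 1, DihedralGroup.r 2,
   DihedralGroup.sr 0, DihedralGroup.sr 1, DihedralGroup.sr 2}

/-- `ΦD6` is a CM type of `D₆` (`decide`). -/
theorem isCMType_ΦD6 : IsCMType cc_D6 ΦD6 := by decide

/-- The right stabiliser of `ΦD6` has order `2` (a lift from a non-Galois sextic subfield). -/
theorem card_rstab_ΦD6 : (univ.filter fun h : D6 => h ∈ rstab ΦD6).card = 2 := by decide

/-- Of the 64 CM types of `D₆`, 24 are primitive (these have rank 7), 36 have a right stabiliser of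
order 2 (lifted from a non-Galois sextic CM subfield; these have rank 4) and 4 are lifted from the
imaginary quadratic subfield (rank 2). -/
theorem card_primitive_cmTypes_D6 : ((cmTypes cc_D6).filter fun Φ => IsPrimitive Φ).card = 24 := by
  decide +kernel

/-- Of the 64 CM types of `D₆`, 36 have a right stabiliser of order `2` (these are the rank-4 types). -/
theorem card_rstab_two_cmTypes_D6 :
    ((cmTypes cc_D6).filter fun Φ => (univ.filter fun h : D6 => h ∈ rstab Φ).card = 2).card = 36 := by
  decide +kernel

/-- Hodge counts of the rank-4 type `ΦD6` (Pohlmann sets of size 2 / 4, exceptional ones of size 4). -/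
theorem hodgeCount_ΦD6_one : hodgeCount cc_D6 ΦD6 1 = 12 := by decide +kernel

/-- `ΦD6` has 51 Pohlmann sets of size `4`. -/
theorem hodgeCount_ΦD6_two : hodgeCount cc_D6 ΦD6 2 = 51 := by decide +kernel

/-- `ΦD6` has 36 exceptional Pohlmann sets of size `4`. -/
theorem exceptionalCount_ΦD6_two : exceptionalCount cc_D6 ΦD6 2 = 36 := by decide +kernel

end HodgeRepro
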